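import Mathlib
import Summits.QuantumFields.YangMills.Theses.SpecificationCompactness
import Summits.QuantumFields.YangMills.Theorems.SpecificationCompactnessGibbsLimitUniquenessDoeblin
import Literature.MathematicalPhysics.QuantumFieldTheory.Balaban1983to89.T3OrbitAverage
import HarnessLib

/-!
# `GibbsLimitUniqueness` (route SpecificationCompactness, support S2, stmt-QuantumFields-28253) — PROVED

THE NEW KERNEL of the line (critic idea-crit-5 #116 «S2 first: Feller specification with positive continuous floor on a finite
product has a unique consistent probability, and spec-merging sequences converge to it»), for Bałaban's renormalised unit laws
`ρ_K = unitLaw expMeanLogSU γ K` on the FIXED unit-lattice configuration space `X₀ = SU(2)^{links of T₁}` with product Haar `π₀`: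

  if `q = (q_e)_e` is a continuous single-link specification with a floor `δ > 0` and unit fibre integrals, and the single-link
  conditional expectations of `ρ_K` merge with the `q`-specification in `L¹(ρ_K)`, then `lim_K ∫ f dρ_K` exists for every
  continuous `f` — `gibbsLimitUniqueness_proof : Theses.SpecificationCompactness.GibbsLimitUniqueness` BY NAME.

PROOF (no Prokhorov, no Riesz–Markov, no subsequences): by `condExp_pi_ae_eq_integral_update` (product-Haar disintegration) the
conditional expectation `E_{π₀}[q_e f | links ≠ e]` is (a.e., and `ρ_K ≪ π₀` by `unitLaw_eq_withDensity_emlDensity`) the CONTINUOUS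
fibre integral `Γ_e f (V) = ∫ q_e(V[e↦w]) f(V[e↦w]) dw`, so the hypothesis says `∫ Γ_e f dρ_K − ∫ f dρ_K → 0`
(`integral_condExp`); by induction over a list of links the same holds for every sweep `Γ_l`; the fibre normalisation
`∫ q_e(V[e↦w]) dw = 1` holds EVERYWHERE (a.e. by hypothesis, continuity, `π₀` charges open sets); a full sweep over an
enumeration of the links is minorised by `δ^{#links}` times the (configuration-independent) pure resampling state
(`sweep_ge_pow_mul_pureSweep`, `pureSweep_eq_of_eqOn_compl`); the abstract Doeblin/Cauchy lemma `exists_tendsto_of_doeblin`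
concludes.

HONEST FRAMING: rung R3 RECORD line (leaf `YM3TorusSU2`, not Clay); this is the route's SUPPORT S2 — measure theory on a finite
product of compact groups.  The cruxes C1 `PointwiseSpecificationLimit` and C2 `UnitDensityUI` stay open; no summit statement
(the YM mass gap) is proved by any of this.  Sources: Friedli–Velenik (2017) Lemma 6.27 / Thm 6.26; Doeblin's minorisation
(Meyn–Tweedie 1993, Thm 16.0.2); Kallenberg (2002) Thm 6.4 for the disintegration; [Balaban1985UV3] (1)–(3) p. 256 for `ρ_K`.
-/

noncomputable section

namespace Summit.QuantumFields.YangMills.Theorems.GibbsLimitUniqueness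

open MeasureTheory Filter Topology Function Set

/-! ## §4 `GibbsLimitUniqueness` for Bałaban's renormalised unit laws on `SU(2)^{links}` -/

section YM

open Literature.MathematicalPhysics.QuantumFieldTheory.Balaban1983to89
open Literature.MathematicalPhysics.QuantumFieldTheory.Balaban1983to89.T3ContinuumYM3Torus
open Literature.MathematicalPhysics.QuantumFieldTheory.Balaban1983to89.T3ThresholdRemoval
open Literature.MathematicalPhysics.QuantumFieldTheory.Balaban1983to89.T3UnitLawDensityEML
open Literature.MathematicalPhysics.QuantumFieldTheory.Balaban1983to89.T3OrbitAverage

/-- **`GibbsLimitUniqueness` (route SpecificationCompactness, support S2, stmt-QuantumFields-28253) HOLDS.**  For every torus family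
`F`, `γ > 0`, and every continuous single-link specification `q = (q_e)_e` on `X₀ = SU(2)^{links of T₁}` with a floor `δ > 0` and
unit fibre integrals (`E_{π₀}[q_e | links ≠ e] = 1` a.e. for product Haar `π₀`): if the single-link conditional expectations of the
renormalised unit laws `ρ_K = unitLaw expMeanLogSU γ K` merge with the `q`-specification in `L¹(ρ_K)` (`∫ |E_{ρ_K}[f | links ≠ e] −
E_{π₀}[q_e f | links ≠ e]| dρ_K → 0` for continuous `f`), then `∫ f dρ_K` converges for EVERY continuous `f` (the unit laws converge
weakly).  PROOF WITHOUT COMPACTNESS OF THE SPACE OF MEASURES: `E_{π₀}[q_e f | links ≠ e]` IS the continuous fibre integral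
`Γ_e f (V) = ∫ q_e(V[e↦w]) f(V[e↦w]) dw` (`condExp_pi_ae_eq_integral_update`, transported to `ρ_K ≪ π₀` by
`unitLaw_eq_withDensity_emlDensity`), so the hypothesis reads `∫ Γ_e f dρ_K − ∫ f dρ_K → 0`; iterating over a list enumerating
the links, `∫ Γ^k f dρ_K − ∫ f dρ_K → 0` for the full sweep `Γ`; the fibre normalisation holds EVERYWHERE (a.e. + continuity +
`π₀` charges open sets); Doeblin (`Γ ≥ δ^{#links}·(pure resampling state)`) contracts oscillations, and `exists_tendsto_of_doeblin`
gives a Cauchy sequence.  Rung R3 RECORD line; no summit statement (YM mass gap) and no crux of the route is proved here.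
[cite: FriedliVelenik2017, Lemma 6.27 and Thm 6.26; MeynTweedie1993, Thm 16.0.2] -/
theorem gibbsLimitUniqueness_proof :
    Summit.QuantumFields.YangMills.Theses.SpecificationCompactness.GibbsLimitUniqueness := by
  intro F γ hγ δ q hq hconv f hf
  obtain ⟨hδ, hqc, hqδ, hqn⟩ := hq
  classical
  -- the objects
  haveI hηP : IsProbabilityMeasure (HaarData.haar : Measure (Matrix.specialUnitaryGroup (Fin 2) ℂ)) := HaarData.isProb
  set η : Measure (Matrix.specialUnitaryGroup (Fin 2) ℂ) := HaarData.haar with hη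
  set P₀ : Measure (GaugeField (F.P 0) 0 (Matrix.specialUnitaryGroup (Fin 2) ℂ)) :=
    fieldMeasure (F.P 0) 0 (Matrix.specialUnitaryGroup (Fin 2) ℂ) with hP0def
  set ρ : ℕ → Measure (GaugeField (F.P 0) 0 (Matrix.specialUnitaryGroup (Fin 2) ℂ)) := fun K =>
    F.unitLaw (ExpMeanLog.expMeanLogSU : LoopAverage (Matrix.specialUnitaryGroup (Fin 2) ℂ))
      T4ApexTwoLevel.measurableE_expMeanLogSU γ K with hρdef
  haveI hρP : ∀ K, IsProbabilityMeasure (ρ K) := fun K =>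
    isProbabilityMeasure_unitLaw T4ApexTwoLevel.measurableE_expMeanLogSU hγ.le K
  haveI hP0pos : P₀.IsOpenPosMeasure := by
    haveI : (HaarData.haar : Measure (Matrix.specialUnitaryGroup (Fin 2) ℂ)).IsOpenPosMeasure := by
      show (Literature.MathematicalPhysics.QuantumFieldTheory.haarProbability
        (Matrix.specialUnitaryGroup (Fin 2) ℂ)).IsOpenPosMeasure
      unfold Literature.MathematicalPhysics.QuantumFieldTheory.haarProbability; infer_instance
    show (Measure.pi fun _ : PBond (F.P 0) 0 => (HaarData.haar : Measure (Matrix.specialUnitaryGroup (Fin 2) ℂ))).IsOpenPosMeasure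
    infer_instance
  have hP0pi : P₀ = Measure.pi fun _ : PBond (F.P 0) 0 => η := rfl
  -- `ρ_K ≪ π₀` (the unit law has a density with respect to product Haar: `unitLaw_eq_withDensity_emlDensity`)
  have hac : ∀ K, ρ K ≪ P₀ := by
    intro K
    have h : F.unitLaw ℰp measurableE_ℰp γ K ≪ P₀ := by
      rw [unitLaw_eq_withDensity_emlDensity F K hγ.le]
      exact withDensity_absolutelyContinuous _ _
    exact h
  -- continuous functions on the compact `X₀` are integrable for every finite measure
  have hint : ∀ (μ : Measure (GaugeField (F.P 0) 0 (Matrix.specialUnitaryGroup (Fin 2) ℂ))) [IsFiniteMeasure μ]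
      (g : GaugeField (F.P 0) 0 (Matrix.specialUnitaryGroup (Fin 2) ℂ) → ℝ), Continuous g → Integrable g μ := by
    intro μ _ g hg
    obtain ⟨C, hC⟩ := isCompact_univ.exists_bound_of_continuousOn (hg.continuousOn (s := Set.univ))
    exact Integrable.of_bound hg.aestronglyMeasurable C (Eventually.of_forall fun V => hC V (Set.mem_univ V))
  have hbounds : ∀ g : GaugeField (F.P 0) 0 (Matrix.specialUnitaryGroup (Fin 2) ℂ) → ℝ, Continuous g →
      ∃ a b : ℝ, ∀ V, a ≤ g V ∧ g V ≤ b := by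
    intro g hg
    obtain ⟨C, hC⟩ := isCompact_univ.exists_bound_of_continuousOn (hg.continuousOn (s := Set.univ))
    refine ⟨-C, C, fun V => ?_⟩
    have h := hC V (Set.mem_univ V)
    rw [Real.norm_eq_abs] at h
    exact abs_le.1 h
  -- (A) the fibre normalisation holds EVERYWHERE
  have hnorm : ∀ e (V : GaugeField (F.P 0) 0 (Matrix.specialUnitaryGroup (Fin 2) ℂ)),
      ∫ w, q e (Function.update V e w) ∂η = 1 := by
    intro e
    have hkey := condExp_pi_ae_eq_integral_update η e (hqc e).stronglyMeasurable (hint P₀ _ (hqc e))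
    have hcont : Continuous fun V : GaugeField (F.P 0) 0 (Matrix.specialUnitaryGroup (Fin 2) ℂ) =>
        ∫ w, q e (Function.update V e w) ∂η := continuous_integral_update η (hqc e) e
    have hae : (fun V : GaugeField (F.P 0) 0 (Matrix.specialUnitaryGroup (Fin 2) ℂ) =>
        ∫ w, q e (Function.update V e w) ∂η) =ᵐ[P₀] fun _ => (1:ℝ) := by
      filter_upwards [hkey, hqn e] with V h1 h2
      rw [← h1]; exact h2
    have heq := (Continuous.ae_eq_iff_eq P₀ hcont continuous_const).1 hae
    exact fun V => congrFun heq V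
  -- (B) one link: `∫ Γ_e g dρ_K − ∫ g dρ_K → 0`
  have hlink : ∀ e (g : GaugeField (F.P 0) 0 (Matrix.specialUnitaryGroup (Fin 2) ℂ) → ℝ), Continuous g →
      Tendsto (fun K => ∫ V, (∫ w, q e (Function.update V e w) * g (Function.update V e w) ∂η) ∂ρ K
        - ∫ V, g V ∂ρ K) atTop (𝓝 0) := by
    intro e g hg
    have hS : Measurable (fun (W : GaugeField (F.P 0) 0 (Matrix.specialUnitaryGroup (Fin 2) ℂ))
        (b : {b : PBond (F.P 0) 0 // b ≠ e}) => W b.1) :=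
      measurable_pi_lambda _ fun b : {b : PBond (F.P 0) 0 // b ≠ e} =>
        (measurable_pi_apply (X := fun _ : PBond (F.P 0) 0 => Matrix.specialUnitaryGroup (Fin 2) ℂ) b.1)
    have hm := hS.comap_le
    have hqg : Continuous fun W : GaugeField (F.P 0) 0 (Matrix.specialUnitaryGroup (Fin 2) ℂ) => q e W * g W :=
      (hqc e).mul hg
    have hkey := condExp_pi_ae_eq_integral_update η e hqg.stronglyMeasurable (hint P₀ _ hqg)
    have hstep : Continuous fun V : GaugeField (F.P 0) 0 (Matrix.specialUnitaryGroup (Fin 2) ℂ) =>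
        ∫ w, q e (Function.update V e w) * g (Function.update V e w) ∂η :=
      continuous_integral_update η hqg e
    have h := hconv e g hg
    have hdiff : ∀ K, ∫ V, (∫ w, q e (Function.update V e w) * g (Function.update V e w) ∂η) ∂ρ K - ∫ V, g V ∂ρ K
        = -∫ V, (condExp (MeasurableSpace.comap (fun (W : GaugeField (F.P 0) 0 (Matrix.specialUnitaryGroup (Fin 2) ℂ))
              (b : {b : PBond (F.P 0) 0 // b ≠ e}) => W b.1) MeasurableSpace.pi) (ρ K) g V
            - condExp (MeasurableSpace.comap (fun (W : GaugeField (F.P 0) 0 (Matrix.specialUnitaryGroup (Fin 2) ℂ))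
              (b : {b : PBond (F.P 0) 0 // b ≠ e}) => W b.1) MeasurableSpace.pi) P₀ (fun W => q e W * g W) V) ∂ρ K := by
      intro K
      have hae : condExp (MeasurableSpace.comap (fun (W : GaugeField (F.P 0) 0 (Matrix.specialUnitaryGroup (Fin 2) ℂ))
            (b : {b : PBond (F.P 0) 0 // b ≠ e}) => W b.1) MeasurableSpace.pi) P₀ (fun W => q e W * g W) =ᵐ[ρ K]
          fun V => ∫ w, q e (Function.update V e w) * g (Function.update V e w) ∂η := (hac K).ae_eq hkey
      have i1 : Integrable (condExp (MeasurableSpace.comap (fun (W : GaugeField (F.P 0) 0 (Matrix.specialUnitaryGroup (Fin 2) ℂ))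
            (b : {b : PBond (F.P 0) 0 // b ≠ e}) => W b.1) MeasurableSpace.pi) (ρ K) g) (ρ K) := integrable_condExp
      have i2 : Integrable (condExp (MeasurableSpace.comap (fun (W : GaugeField (F.P 0) 0 (Matrix.specialUnitaryGroup (Fin 2) ℂ))
            (b : {b : PBond (F.P 0) 0 // b ≠ e}) => W b.1) MeasurableSpace.pi) P₀ (fun W => q e W * g W)) (ρ K) :=
        (hint (ρ K) _ hstep).congr hae.symm
      rw [integral_sub i1 i2, integral_condExp hm, integral_congr_ae hae]
      ring
    rw [show (fun K => ∫ V, (∫ w, q e (Function.update V e w) * g (Function.update V e w) ∂η) ∂ρ K - ∫ V, g V ∂ρ K)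
        = fun K => -∫ V, (condExp (MeasurableSpace.comap (fun (W : GaugeField (F.P 0) 0 (Matrix.specialUnitaryGroup (Fin 2) ℂ))
              (b : {b : PBond (F.P 0) 0 // b ≠ e}) => W b.1) MeasurableSpace.pi) (ρ K) g V
            - condExp (MeasurableSpace.comap (fun (W : GaugeField (F.P 0) 0 (Matrix.specialUnitaryGroup (Fin 2) ℂ))
              (b : {b : PBond (F.P 0) 0 // b ≠ e}) => W b.1) MeasurableSpace.pi) P₀ (fun W => q e W * g W) V) ∂ρ K
        from funext hdiff]
    rw [← neg_zero]
    refine Tendsto.neg (squeeze_zero_norm (fun K => ?_) h)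
    rw [Real.norm_eq_abs]
    exact abs_integral_le_integral_abs
  -- (C) sweeps: `∫ Γ_l g dρ_K − ∫ g dρ_K → 0`
  have hsweep : ∀ (l : List (PBond (F.P 0) 0)) (g : GaugeField (F.P 0) 0 (Matrix.specialUnitaryGroup (Fin 2) ℂ) → ℝ),
      Continuous g → Tendsto (fun K => ∫ V, l.foldr (fun e g' => fun V : GaugeField (F.P 0) 0 (Matrix.specialUnitaryGroup (Fin 2) ℂ) =>
        ∫ w, q e (Function.update V e w) * g' (Function.update V e w) ∂η) g V ∂ρ K - ∫ V, g V ∂ρ K) atTop (𝓝 0) := by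
    intro l g hg
    induction l with
    | nil => simp only [List.foldr_nil, sub_self]; exact tendsto_const_nhds
    | cons e l ih =>
      have hcl : Continuous (l.foldr (fun e g' => fun V : GaugeField (F.P 0) 0 (Matrix.specialUnitaryGroup (Fin 2) ℂ) =>
          ∫ w, q e (Function.update V e w) * g' (Function.update V e w) ∂η) g) := continuous_sweep η hqc hg l
      have h2 := (hlink e (l.foldr (fun e g' => fun V : GaugeField (F.P 0) 0 (Matrix.specialUnitaryGroup (Fin 2) ℂ) =>
          ∫ w, q e (Function.update V e w) * g' (Function.update V e w) ∂η) g) hcl).add ih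
      rw [add_zero] at h2
      refine h2.congr' (Eventually.of_forall fun K => ?_)
      simp only [List.foldr_cons]
      ring
  -- (D) Doeblin for the full sweep over an enumeration of the links
  set l₀ : List (PBond (F.P 0) 0) := (Finset.univ : Finset (PBond (F.P 0) 0)).toList with hl₀
  have hl₀mem : ∀ i : PBond (F.P 0) 0, i ∈ l₀ := fun i => Finset.mem_toList.2 (Finset.mem_univ i)
  have hone : ∀ e (V : GaugeField (F.P 0) 0 (Matrix.specialUnitaryGroup (Fin 2) ℂ)),
      ∫ w, (fun (_ : PBond (F.P 0) 0) (_ : GaugeField (F.P 0) 0 (Matrix.specialUnitaryGroup (Fin 2) ℂ)) => (1:ℝ)) e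
        (Function.update V e w) ∂η = 1 := by
    intro e V; simp
  refine exists_tendsto_of_doeblin (fun g => Continuous g)
    (fun g => l₀.foldr (fun e g' => fun V : GaugeField (F.P 0) 0 (Matrix.specialUnitaryGroup (Fin 2) ℂ) =>
        ∫ w, q e (Function.update V e w) * g' (Function.update V e w) ∂η) g)
    (fun g => l₀.foldr (fun e g' => fun V : GaugeField (F.P 0) 0 (Matrix.specialUnitaryGroup (Fin 2) ℂ) =>
        ∫ w, (fun (_ : PBond (F.P 0) 0) (_ : GaugeField (F.P 0) 0 (Matrix.specialUnitaryGroup (Fin 2) ℂ)) => (1:ℝ)) e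
          (Function.update V e w) * g' (Function.update V e w) ∂η) g 1)
    (fun K g => ∫ V, g V ∂ρ K) (pow_pos hδ l₀.length)
    (fun g hg => continuous_sweep η hqc hg l₀)
    (fun g a b hg => (continuous_const.mul hg).add continuous_const)
    hbounds
    (fun g a b hg => sweep_affine η hqc hnorm hg a b l₀)
    (fun g a b hg => ?_) (fun g hg hg0 V => ?_) (fun K g a b hg hab => ?_) (fun g hg => hsweep l₀ g hg) hf
  · -- the minorising state is affine
    have h := sweep_affine η (q := fun (_ : PBond (F.P 0) 0) (_ : GaugeField (F.P 0) 0 (Matrix.specialUnitaryGroup (Fin 2) ℂ)) => (1:ℝ))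
      (fun _ => continuous_const) hone hg a b l₀
    exact congrFun h 1
  · -- minorisation: `Γ g ≥ δ^{#links} · P g (V) = δ^{#links} · P g (1)`
    have h := sweep_ge_pow_mul_pureSweep η hqc hδ.le hqδ hg hg0 l₀ V
    rw [pureSweep_eq_of_eqOn_compl η l₀ V 1 (fun i hi => absurd (hl₀mem i) hi)] at h
    exact h
  · -- states are monotone and normalised
    have hgi : Integrable g (ρ K) := hint (ρ K) g hg
    constructor
    · have h := integral_mono (integrable_const a) hgi (fun V => (hab V).1)
      simpa using h
    · have h := integral_mono hgi (integrable_const b) (fun V => (hab V).2)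
      simpa using h

end YM

end Summit.QuantumFields.YangMills.Theorems.GibbsLimitUniqueness

end
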